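import Summits.NavierStokesRegularity.NavierStokesRegularity.Theses.QuantisedSymmetry
import Summits.NavierStokesRegularity.NavierStokesRegularity.Theses.Blowup
import Summits.NavierStokesRegularity.NavierStokesRegularity.Theses.FilamentSkeletonRss
import Summits.NavierStokesRegularity.NavierStokesRegularity.Theorems.QuantisedSymmetryPolyhedralTruncationBridge
import Summits.NavierStokesRegularity.NavierStokesRegularity.Theorems.QuantisedSymmetryPolyhedralDssProfileExistsDominatesBlowupProfile
import Summits.NavierStokesRegularity.NavierStokesRegularity.Theorems.QuantisedSymmetryLiouvilleKillsProfile
import Summits.NavierStokesRegularity.NavierStokesRegularity.Theorems.FilamentSkeletonRssRdssProfileTruncation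
import Literature.Analysis.FluidPDE.SelfSimilar
import Literature.Analysis.FluidPDE.SelfSimilarLiouville
import HarnessLib

/-!
# Strategist sketch s19-g10 — crux `PolyhedralDssProfileExists` (X⁻, stmt-NavierStokesRegularity-1404),
# route `QuantisedSymmetry`

Kernel-checked companion of `STRATEGY-CENSUS-s19.md` (planner, crux-strategist, census family `s`,
gen 10, independent census). Nothing here is a line or a stub: every theorem is PROVED (no `sorry`) and
records one structural fact used by the census.

* §0 `crux_decides` — X⁻ ALONE refutes the summit today (`closes` with the landed bridge proof and
  `ClayUniqueness_holds`). No converse is known (a blow-up need not be Type I, DSS or polyhedral).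
* §1 weaker intermediates ON THE SUMMIT PATH: X⁻ ⟹ W₁ (`Blowup.BlowupTypeIDssProfile`, stmt-0155)
  ⟹ W₁' (`RdssProfileExists`, the antecedent of `FilamentSkeletonRss.RdssProfileTruncation`, stmt-11289)
  ⟹ X5a (`Blowup.BlowupExists`) ⟹ ¬S — every one of them still DECIDES the summit
  (`W1_decides`, `rdssProfileExists_decides`), so none is "short of the summit".
* §2 a weaker consequence OFF the path: X⁻ ⟹ ¬`PolyhedralTypeILiouville` (contrapositive of the landed
  kill switch); it does not feed `closes`.
* §3 the ε-approximation ∧ compactness split (D-E of the census), typed over an abstract nearness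
  predicate, with its assembly `crux_of_split` PROVED and its COLLAPSE `collapse` PROVED: as soon as the
  compactness half holds (and exact profiles count as near), the approximation half is EQUIVALENT to X⁻.
-/

set_option linter.dupNamespace false
set_option autoImplicit false

namespace Summit.NavierStokesRegularity.NavierStokesRegularity.Cruxes.PolyhedralDssProfileExists.StrategistS19g10

open MeasureTheory
open Literature.Analysis.FluidPDE
open _root_.Summit.NavierStokesRegularity.NavierStokesRegularity.Theses

local notation "ℝ³" => EuclideanSpace ℝ (Fin 3)

/-! ## §0 The crux alone decides the summit -/

/-- X⁻ alone refutes Clay (A) today: the other two binders of the route's deciding theorem are landed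
theorems (`quantisedSymmetry_polyhedralTruncationBridge_proof`, `ClayUniqueness_holds`). [folklore] -/
theorem crux_decides (hX : QuantisedSymmetry.PolyhedralDssProfileExists) : ¬ _root_.NavierStokesRegularity :=
  QuantisedSymmetry.closes hX
    _root_.Summit.NavierStokesRegularity.NavierStokesRegularity.Theorems.quantisedSymmetry_polyhedralTruncationBridge_proof
    QuantisedSymmetry.ClayUniqueness_holds

/-! ## §1 Weaker intermediates on the summit path all decide the summit -/

/-- W₁' — existence of a nontrivial Type-I ROTATED-`λ`-DSS ancient mild profile (the antecedent of
`FilamentSkeletonRss.RdssProfileTruncation`, stmt-NavierStokesRegularity-11289; no symmetry group, any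
rotation `R ∈ O(3)`). -/
def RdssProfileExists : Prop :=
  ∃ (c : ℝ) (R : ℝ³ ≃ₗᵢ[ℝ] ℝ³) (u : ℝ → ℝ³ → ℝ³), 1 < c ∧ IsAncientMildSolution 1 u ∧
    (∀ t < 0, AEStronglyMeasurable (u t) volume) ∧ IsRotatedDSS c R u ∧
      (∃ C₀ : ℝ, HasTypeIDecay C₀ u) ∧ ¬ (∀ t < 0, u t =ᵐ[volume] 0)

/-- X⁻ ⟹ W₁ (registered stub of line `polyhedral_cell`, landed). [folklore] -/
theorem crux_implies_W1 :
    QuantisedSymmetry.PolyhedralDssProfileExists → Blowup.BlowupTypeIDssProfile :=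
  _root_.Summit.NavierStokesRegularity.NavierStokesRegularity.Theorems.PolyhedralDssProfileExists.PolyhedralCell.stub_dominatesBlowupProfile

/-- W₁ ⟹ W₁' (classical logic: the negated Liouville conjunction produces a profile, plain DSS being
rotated DSS with `R = 1`). [folklore] -/
theorem rdssProfileExists_of_W1 (h : Blowup.BlowupTypeIDssProfile) : RdssProfileExists := by
  unfold Blowup.BlowupTypeIDssProfile at h
  by_contra H
  apply h
  intro c
  refine ⟨?_, fun R => ?_⟩
  · intro hc u hanc hmeas hdss hdec
    by_contra hnt
    exact H ⟨c, LinearIsometryEquiv.refl ℝ ℝ³, u, hc, hanc, hmeas, isRotatedDSS_refl_iff.mpr hdss, hdec, hnt⟩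
  · intro hc u hanc hmeas hrdss hdec
    by_contra hnt
    exact H ⟨c, R, u, hc, hanc, hmeas, hrdss, hdec, hnt⟩

/-- W₁' ⟹ W₁ (a rotated profile refutes the rotated Liouville conjunct at its own `(λ, R)`). [folklore] -/
theorem W1_of_rdssProfileExists (h : RdssProfileExists) : Blowup.BlowupTypeIDssProfile := by
  obtain ⟨c, R, u, hc, hanc, hmeas, hrdss, hdec, hnt⟩ := h
  unfold Blowup.BlowupTypeIDssProfile
  intro hL
  exact hnt ((hL c).2 R hc u hanc hmeas hrdss hdec)

/-- W₁' ⟹ X5a: the landed rotated truncation bridge (`filamentSkeletonRss_rdssProfileTruncation_proof`). [folklore] -/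
theorem blowupExists_of_rdssProfileExists (h : RdssProfileExists) : Blowup.BlowupExists :=
  _root_.Summit.NavierStokesRegularity.NavierStokesRegularity.Theorems.filamentSkeletonRss_rdssProfileTruncation_proof h

/-- W₁' decides the summit (bridge + `Blowup.closes` + `BlowupClayUniqueness_holds`). [folklore] -/
theorem rdssProfileExists_decides (h : RdssProfileExists) : ¬ _root_.NavierStokesRegularity :=
  Blowup.closes (blowupExists_of_rdssProfileExists h) Blowup.BlowupClayUniqueness_holds

/-- W₁ decides the summit. [folklore] -/
theorem W1_decides (h : Blowup.BlowupTypeIDssProfile) : ¬ _root_.NavierStokesRegularity :=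
  rdssProfileExists_decides (rdssProfileExists_of_W1 h)

/-! ## §2 A weaker consequence off the summit path -/

/-- X⁻ ⟹ ¬ PolyhedralTypeILiouville (contrapositive of the landed kill switch `LiouvilleKillsProfile`);
this consequence is strictly weaker in content but feeds no deciding theorem. [folklore] -/
theorem not_polyhedralLiouville_of_crux (hX : QuantisedSymmetry.PolyhedralDssProfileExists) :
    ¬ QuantisedSymmetry.PolyhedralTypeILiouville := fun hL =>
  _root_.Summit.NavierStokesRegularity.NavierStokesRegularity.Theorems.quantisedSymmetry_liouvilleKillsProfile_proof
    hL hX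

/-! ## §3 The approximation ∧ compactness split and its collapse -/

/-- The group-theoretic clauses of X⁻. -/
def IsPolyGroup (G : Subgroup (ℝ³ ≃ₗᵢ[ℝ] ℝ³)) : Prop :=
  Finite G ∧ (∀ g ∈ G, LinearMap.det (g.toLinearEquiv : ℝ³ →ₗ[ℝ] ℝ³) = 1) ∧
    (∀ V : Submodule ℝ ℝ³, (∀ g ∈ G, ∀ v ∈ V, g v ∈ V) → V = ⊥ ∨ V = ⊤)

/-- The analytic clauses of X⁻: `u` is an exact nontrivial `G`-equivariant Type-I `c`-DSS ancient mild profile. -/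
def IsPolyProfile (G : Subgroup (ℝ³ ≃ₗᵢ[ℝ] ℝ³)) (c : ℝ) (u : ℝ → ℝ³ → ℝ³) : Prop :=
  IsAncientMildSolution 1 u ∧ (∀ t < 0, AEStronglyMeasurable (u t) volume) ∧ IsDiscretelySelfSimilar c u ∧
    (∃ C₀ : ℝ, HasTypeIDecay C₀ u) ∧ (∀ g ∈ G, ∀ t x, u t (g x) = g (u t x)) ∧ ¬ (∀ t < 0, u t =ᵐ[volume] 0)

theorem crux_iff : QuantisedSymmetry.PolyhedralDssProfileExists ↔
    ∃ G, IsPolyGroup G ∧ ∃ c : ℝ, 1 < c ∧ ∃ u, IsPolyProfile G c u := by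
  unfold QuantisedSymmetry.PolyhedralDssProfileExists IsPolyGroup IsPolyProfile
  constructor
  · rintro ⟨G, hfin, hdet, hirr, c, hc, u, hu⟩
    exact ⟨G, ⟨hfin, hdet, hirr⟩, c, hc, u, hu⟩
  · rintro ⟨G, ⟨hfin, hdet, hirr⟩, c, hc, u, hu⟩
    exact ⟨G, hfin, hdet, hirr, c, hc, u, hu⟩

section Split

/- Abstract nearness: `Near G c ε u` reads "`u` is a normalised `ε`-approximate solution of the
`G`-equivariant `c`-DSS cell problem" (any concrete choice: residual of the cell map `𝓡_G` in a norm in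
which Type-I-bounded sets are precompact, with a normalisation surviving limits). -/
variable (Near : Subgroup (ℝ³ ≃ₗᵢ[ℝ] ℝ³) → ℝ → ℝ → (ℝ → ℝ³ → ℝ³) → Prop)

/-- D-E, piece 1 (ε-approximate profiles exist for every ε). -/
def ApproxProfiles : Prop :=
  ∃ G, IsPolyGroup G ∧ ∃ c : ℝ, 1 < c ∧ ∀ ε > 0, ∃ u, Near G c ε u

/-- D-E, piece 2 (compactness / closedness: a family of ever-better approximate profiles has an exact,
nontrivial limit profile). For the natural `Near` this is KNSS a-priori bounds + Arzelà–Ascoli exactly as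
in the tree's `ChaeWolf.exists_limit`. -/
def Compactness : Prop :=
  ∀ G, IsPolyGroup G → ∀ c : ℝ, 1 < c → (∀ ε > 0, ∃ u, Near G c ε u) → ∃ u, IsPolyProfile G c u

/-- Soundness of the nearness notion: an exact profile is `ε`-near for every `ε`. -/
def Soundness : Prop :=
  ∀ G c u, IsPolyProfile G c u → ∀ ε > 0, Near G c ε u

/-- ASSEMBLY of the split, proved: piece 1 → piece 2 → X⁻. [folklore] -/
theorem crux_of_split (h₁ : ApproxProfiles Near) (h₂ : Compactness Near) :
    QuantisedSymmetry.PolyhedralDssProfileExists := by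
  obtain ⟨G, hG, c, hc, happrox⟩ := h₁
  obtain ⟨u, hu⟩ := h₂ G hG c hc happrox
  exact crux_iff.mpr ⟨G, hG, c, hc, u, hu⟩

/-- Converse direction: X⁻ gives piece 1 for any sound nearness notion. [folklore] -/
theorem approx_of_crux (hs : Soundness Near) (hX : QuantisedSymmetry.PolyhedralDssProfileExists) :
    ApproxProfiles Near := by
  obtain ⟨G, hG, c, hc, u, hu⟩ := crux_iff.mp hX
  exact ⟨G, hG, c, hc, fun ε hε => ⟨u, hs G c u hu ε hε⟩⟩

/-- COLLAPSE of the split: once the compactness half is in hand (for a sound nearness notion), the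
approximation half is EQUIVALENT to the crux — the split isolates nothing strictly weaker. [folklore] -/
theorem collapse (hs : Soundness Near) (h₂ : Compactness Near) :
    ApproxProfiles Near ↔ QuantisedSymmetry.PolyhedralDssProfileExists :=
  ⟨fun h₁ => crux_of_split Near h₁ h₂, approx_of_crux Near hs⟩

end Split

end Summit.NavierStokesRegularity.NavierStokesRegularity.Cruxes.PolyhedralDssProfileExists.StrategistS19g10
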